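import Literature.AlgebraicGeometry.Deformation.MilnorAlgebraLinearCoordinateChange
import Literature.RingTheory.MvPolynomial.PrincipalIdealRadicalFormula
import Mathlib.LinearAlgebra.Matrix.Adjugate
import Mathlib.LinearAlgebra.Matrix.NonsingularInverse
import HarnessLib

/-!
# Gordan–Nöther's criterion: a variable can be eliminated from a form by a linear change of coordinates iff its partial
# derivatives are linearly dependent

`Literature/RingTheory/MvPolynomial/GordanNoetherCriterion.lean`. Watanabe–de Bondt, *On the theory of Gordan–Noether on homogeneous
forms with zero Hessian* (held `paper:arxiv-1703.07624`, chunk p0007), Proposition 4.8: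

> «… the following conditions are equivalent. (a) The ideal `𝓘(f(x))` contains a linear form. (b) The partial derivatives of `f(x)` are
> linearly dependent. (c) A variable can be eliminated from `f(x)` by means of a linear transformation of the variables.
> *Proof.* … Suppose that there exists a non-trivial relation `a_1 f_1 + a_2 f_2 + ⋯ + a_n f_n = 0`, where `f_j = ∂f/∂x_j` and `a_j ∈ K`.
> It is possible to choose a set of linearly independent linear forms `y_1, …, y_n` in `x_1, …, x_n` such that `∂x_j/∂y_1 = a_j`. Then
> `∂f/∂y_1 = Σ_j (∂f/∂x_j)(∂x_j/∂y_1) = 0`.» (and «the same argument shows the opposite implication as well»).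

This is the mechanism behind «Hesse's "Theorem"» [Olver1999, Ch. 10]: Hesse claimed `H[f] ≡ 0` iff (c); Gordan–Nöther showed (c) ⟺ (b),
which `H ≡ 0` does NOT imply in `≥ 5` variables (tree `GordanNoetherHessianCounterexample`).

Typed here, for `f : MvPolynomial (Fin n) K` over a field `K` (any characteristic), with «linear transformation of the variables» =
the substitution `x ↦ Mx`, `bind₁ M.toMvPolynomial` of the tree (`MilnorAlgebraLinearCoordinateChange`, `PlaneCurves/HessianCovariance`),
`M` invertible (`M * N = 1`), and «`y_k` eliminated» = `∂_k (f(Mx)) = 0`: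
* `pderiv_bind₁_toMvPolynomial_eq_bind₁_sum` — the chain rule in the form `∂_k (f(Mx)) = (Σ_i M_{ik} ∂_i f)(Mx)`;
* **`det_hessianMatrix_eq_zero_of_sum_smul_pderiv_eq_zero`** — the TRUE direction of Hesse's claim in Gordan–Nöther's form:
  (b) ⟹ `H[f] = det (∂_i∂_j f) ≡ 0` (the relation vector is in the kernel of the Hessian matrix; any commutative ring);
* **`not_linearIndependent_of_pderiv_bind₁_eq_zero`** ((c) ⇒ (b)) and **`exists_pderiv_bind₁_eq_zero_of_sum_smul_pderiv_eq_zero`**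
  ((b) ⇒ (c): the matrix `1.updateCol k a`, `det = a_k ≠ 0`, realises `∂x_j/∂y_k = a_j`);
* **`exists_pderiv_bind₁_eq_zero_iff_not_linearIndependent`** ((b) ⟺ (c)), and in characteristic `0` the literal reading of (c),
  **`exists_notMem_vars_bind₁_iff_not_linearIndependent`**: `∃` invertible `M` and `k` with `x_k ∉ vars (f(Mx))` (via the tree's
  `PrincipalIdealRadicalFormula.pderiv_eq_zero_iff_notMem_vars`, [CoxLittleOShea2007, Ch. 4 § 2 Ex. 13(b)]).

HONEST SCOPE. (a) (the ideal of algebraic relations among the partials) is not typed; in positive characteristic «eliminated» is typed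
only as the derivative-free-ness `∂_k (f(Mx)) = 0` (weaker there: `x_k^p`); no homogeneity is needed or assumed.

## References
* [WatanabeBondt2017] J. Watanabe, M. de Bondt, arXiv:1703.07624 (PRAAG 2018, Springer PROMS 319 (2020) 73–107), Proposition 4.8.
* [Olver1999] P. J. Olver, *Classical Invariant Theory*, Ch. 10, «Hesse's "Theorem"» (held chunk p0237).
* [CoxLittleOShea2007] D. Cox, J. Little, D. O'Shea, *Ideals, Varieties, and Algorithms*, Ch. 4 § 2 Ex. 13(b) (via the tree's
  `Literature/RingTheory/MvPolynomial/PrincipalIdealRadicalFormula.lean`).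

## Provenance
Cell `pub-hsemireg`, lineage hsemireg-lit-8 (g27), 2026-09-02. Theorems only (no `def`, no instance, no notation, no named fact; net debt 0).
-/

noncomputable section

open MvPolynomial Matrix

namespace Literature.RingTheory.MvPolynomial.GordanNoetherCriterion

variable {K : Type*} [CommRing K] {n : ℕ}

/-- **Chain rule, packaged: `∂_k (f(Mx)) = (Σ_i M_{ik} · ∂_i f)(Mx)`** («`∂f/∂y_1 = Σ_j (∂f/∂x_j)(∂x_j/∂y_1)`»).
[cite: WatanabeBondt2017, Proposition 4.8 (proof)] -/
theorem pderiv_bind₁_toMvPolynomial_eq_bind₁_sum (M : Matrix (Fin n) (Fin n) K) (f : MvPolynomial (Fin n) K) (k : Fin n) :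
    pderiv k (bind₁ M.toMvPolynomial f) = bind₁ M.toMvPolynomial (∑ i, M i k • pderiv i f) := by
  rw [AlgebraicGeometry.PlaneCurves.pderiv_bind₁_toMvPolynomial, map_sum]
  exact Finset.sum_congr rfl fun i _ => by rw [smul_eq_C_mul, map_mul, bind₁_C_right]

/-- A square matrix over a commutative ring killing a vector with a regular entry has determinant zero
(`M v = 0 ⟹ det M • v = adj M · M · v = 0`). [folklore] -/
private theorem det_eq_zero_of_mulVec_eq_zero {A : Type*} [CommRing A] {m : Type*} [Fintype m] [DecidableEq m]
    {M : Matrix m m A} {v : m → A} (hv : M *ᵥ v = 0) {i : m} (hi : IsRegular (v i)) : M.det = 0 := by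
  have h : M.det • v = 0 := by
    calc M.det • v = (M.det • (1 : Matrix m m A)) *ᵥ v := by rw [smul_mulVec, one_mulVec]
      _ = (M.adjugate * M) *ᵥ v := by rw [adjugate_mul]
      _ = M.adjugate *ᵥ (M *ᵥ v) := (mulVec_mulVec _ _ _).symm
      _ = 0 := by rw [hv, mulVec_zero]
  have h2 : M.det * v i = 0 * v i := by rw [zero_mul]; exact congr_fun h i
  exact hi.right h2

/-- `C a` is a regular element of the polynomial ring when `a` is regular. [folklore] -/
private theorem isRegular_C {a : K} (ha : IsRegular a) : IsRegular (C a : MvPolynomial (Fin n) K) := by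
  have hl : IsLeftRegular (C a : MvPolynomial (Fin n) K) := fun p q h => by
    ext m
    have h1 := congr_arg (coeff m) h
    simp only [coeff_C_mul] at h1
    exact ha.left h1
  exact ⟨hl, hl.right_of_commute fun b => Commute.all _ b⟩

/-- **Hesse's «theorem», the TRUE direction, in Gordan–Nöther's form: a non-trivial linear relation `Σ_i a_i ∂_i f = 0` among the
partial derivatives (some `a_k` a non-zero-divisor) forces `H[f] = det (∂_i∂_j f) ≡ 0`** — the constant vector `a` is in the kernel of
the Hessian matrix: `Σ_j ∂_i∂_j f · a_j = ∂_i (Σ_j a_j ∂_j f) = 0` («That such functions have zero Hessian is readily seen»). Any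
commutative ring. [cite: Olver1999, Ch. 10, «Hesse's "Theorem"» and (10.10)] [cite: WatanabeBondt2017, Proposition 4.8] -/
theorem det_hessianMatrix_eq_zero_of_sum_smul_pderiv_eq_zero {f : MvPolynomial (Fin n) K} {a : Fin n → K}
    (ha : ∑ i, a i • pderiv i f = 0) {k : Fin n} (hk : IsRegular (a k)) :
    (Matrix.of fun i j : Fin n => pderiv i (pderiv j f)).det = 0 := by
  refine det_eq_zero_of_mulVec_eq_zero (v := fun i => C (a i)) ?_ (i := k) (isRegular_C hk)
  funext i
  have h : pderiv i (∑ j, a j • pderiv j f) = 0 := by rw [ha, map_zero]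
  rw [map_sum] at h
  simp only [mulVec, dotProduct, Matrix.of_apply, Pi.zero_apply]
  refine Eq.trans (Finset.sum_congr rfl fun j _ => ?_) h
  rw [smul_eq_C_mul, Derivation.leibniz, pderiv_C, smul_zero, add_zero, smul_eq_mul, mul_comm]

/-- **(c) ⇒ (b): if a variable can be eliminated from `f` by an invertible linear substitution — `∂_k (f(Mx)) = 0` with `M N = 1` —
then the partial derivatives of `f` are linearly dependent** (the `k`-th column of `M` is a non-trivial relation; `K` non-trivial).
[cite: WatanabeBondt2017, Proposition 4.8 (c) ⇒ (b)] -/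
theorem not_linearIndependent_of_pderiv_bind₁_eq_zero [Nontrivial K] {M N : Matrix (Fin n) (Fin n) K} (hMN : M * N = 1)
    {f : MvPolynomial (Fin n) K} {k : Fin n} (hk : pderiv k (bind₁ M.toMvPolynomial f) = 0) :
    ¬ LinearIndependent K (fun i : Fin n => pderiv i f) := by
  rw [Fintype.not_linearIndependent_iff]
  refine ⟨fun i => M i k, ?_, ?_⟩
  · rw [pderiv_bind₁_toMvPolynomial_eq_bind₁_sum] at hk
    exact AlgebraicGeometry.Deformation.LichtenbaumSchlessinger.Hypersurface.bind₁_toMvPolynomial_injective_of_mul_eq_one hMN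
      (by rw [hk, map_zero])
  · by_contra h
    push Not at h
    have h1 : (N * M) k k = 0 := by
      rw [Matrix.mul_apply]
      exact Finset.sum_eq_zero fun j _ => by rw [h j, mul_zero]
    rw [mul_eq_one_comm.mp hMN, Matrix.one_apply_eq] at h1
    exact one_ne_zero h1

end Literature.RingTheory.MvPolynomial.GordanNoetherCriterion

namespace Literature.RingTheory.MvPolynomial.GordanNoetherCriterion

variable {K : Type*} [Field K] {n : ℕ}

/-- **(b) ⇒ (c): a non-trivial linear relation `Σ_i a_i ∂_i f = 0`, `a_k ≠ 0`, is realised by the invertible substitution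
`M = 1.updateCol k a` («linearly independent linear forms `y_1, …, y_n` … such that `∂x_j/∂y_1 = a_j`»; `det M = a_k`), after which
`∂_k (f(Mx)) = 0`.** [cite: WatanabeBondt2017, Proposition 4.8 (b) ⇒ (c)] -/
theorem exists_pderiv_bind₁_eq_zero_of_sum_smul_pderiv_eq_zero {f : MvPolynomial (Fin n) K} {a : Fin n → K}
    (ha : ∑ i, a i • pderiv i f = 0) {k : Fin n} (hk : a k ≠ 0) :
    ∃ M N : Matrix (Fin n) (Fin n) K, M * N = 1 ∧ (∀ i, M i k = a i) ∧ pderiv k (bind₁ M.toMvPolynomial f) = 0 := by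
  set M : Matrix (Fin n) (Fin n) K := (1 : Matrix (Fin n) (Fin n) K).updateCol k a with hM
  have hdet : M.det = a k := by
    rw [hM, ← cramer_apply, cramer_one]
    rfl
  have hunit : IsUnit M.det := by rw [hdet]; exact (Ne.isUnit hk)
  have hcol : ∀ i, M i k = a i := fun i => by rw [hM, updateCol_self]
  refine ⟨M, M⁻¹, mul_nonsing_inv M hunit, hcol, ?_⟩
  rw [pderiv_bind₁_toMvPolynomial_eq_bind₁_sum]
  simp only [hcol, ha, map_zero]

/-- **Gordan–Nöther's criterion ((b) ⟺ (c) of Watanabe–de Bondt Prop. 4.8): a variable can be eliminated from `f` by an invertible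
linear change of coordinates iff the partial derivatives of `f` are linearly dependent.**
[cite: WatanabeBondt2017, Proposition 4.8 (b) ⇔ (c)] [cite: Olver1999, Ch. 10, «Hesse's "Theorem"» (the claim it corrects)] -/
theorem exists_pderiv_bind₁_eq_zero_iff_not_linearIndependent (f : MvPolynomial (Fin n) K) :
    (∃ M N : Matrix (Fin n) (Fin n) K, M * N = 1 ∧ ∃ k, pderiv k (bind₁ M.toMvPolynomial f) = 0) ↔
      ¬ LinearIndependent K (fun i : Fin n => pderiv i f) := by
  constructor
  · rintro ⟨M, N, hMN, k, hk⟩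
    exact not_linearIndependent_of_pderiv_bind₁_eq_zero hMN hk
  · intro h
    obtain ⟨a, ha, k, hk⟩ := Fintype.not_linearIndependent_iff.mp h
    obtain ⟨M, N, hMN, -, hk0⟩ := exists_pderiv_bind₁_eq_zero_of_sum_smul_pderiv_eq_zero ha hk
    exact ⟨M, N, hMN, k, hk0⟩

/-- **Gordan–Nöther's criterion, literal form in characteristic `0`: there is an invertible linear change of coordinates after which
`f` does not involve one of the variables iff the partial derivatives of `f` are linearly dependent.**
[cite: WatanabeBondt2017, Proposition 4.8 (b) ⇔ (c)] -/
theorem exists_notMem_vars_bind₁_iff_not_linearIndependent [CharZero K] (f : MvPolynomial (Fin n) K) :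
    (∃ M N : Matrix (Fin n) (Fin n) K, M * N = 1 ∧ ∃ k, k ∉ (bind₁ M.toMvPolynomial f).vars) ↔
      ¬ LinearIndependent K (fun i : Fin n => pderiv i f) := by
  simp only [← PrincipalIdealRadicalFormula.pderiv_eq_zero_iff_notMem_vars]
  exact exists_pderiv_bind₁_eq_zero_iff_not_linearIndependent f

end Literature.RingTheory.MvPolynomial.GordanNoetherCriterion
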